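import Summits.ValiantsHypothesis.ValiantsHypothesis.Theorems.LacunarySymmetroidMatrixDescartesCensusDoorA34HollowCornerR2

/-!
# `MatrixDescartes` census — DOOR A at `(3,4)`: the ANNIHILATOR DICHOTOMY (non-zero discriminant ⇒ really split OR unique simple real
# root) and the COMBINED CHART REDUCTION of the Door-A row off the discriminant

HONEST FRAMING.  Object-search cell `pub-symmetroid`, door-A seat `val-sym-door-p3` (g17); item stmt-ValiantsHypothesis-19980
`DoorA34 = PosRootLawAt 3 4 18` is OPEN and asserted nowhere in this file.  Nothing here bounds `ζ_sym(3,4)`; nothing bears on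
`MatrixDescartes` (stmt-ValiantsHypothesis-18050) or on `VP ≠ VNP`.

CONTENT (all supports; no `def`, no `sorry`).
* §11 `exists_root_cubic_of_pos`, `exists_root_cubic` (a real cubic has a real root — intermediate value theorem on `[−M, M]`),
  **`cubic_discr_at_root`** (`Disc(p) = p′(μ)²·Disc(residual quadratic)` at a root `μ`), `det_sub_smul_expand`
  (`det(B₂ − xB₁) = det B₂ − x·tr(adj B₂·B₁) + x²·tr(adj B₁·B₂) − x³·det B₁`), **`annihilator_dichotomy`**: `det B₁ ≠ 0` and the
  DISCRIMINANT of that cubic `≠ 0` ⇒ EITHER three distinct real roots (the hypotheses of `exists_congr_signedEqualDiag`) OR a unique real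
  root which is simple (the hypotheses of `exists_congr_hollowCorner_of_uniqueRoot`);
* §12 **`card_posRoots_le_of_chartRows`** — THE COMBINED REDUCTION: if on `d` every signed-equal-diagonal pencil AND every hollow-corner
  pencil has `≤ N` distinct positive det-roots, then so does every real symmetric `(3,4)` pencil on `d` whose net is annihilated by symmetric
  `B₁, B₂` with `det B₁ ≠ 0` and non-zero discriminant — i.e. every net OFF THE DISCRIMINANT HYPERSURFACE of its annihilator pencil.
With `…CensusOffHypersurface` (`doorA34_iff_rows_off_hypersurface`) only the explicit polynomial annihilator basis `B₁(S), B₂(S)` and one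
witness `Φ(S₀) ≠ 0` separate this from «`DoorA34` ⟺ sixteen-parameter chart rows» (companion file `…CensusDoorA34ChartAtlas`, if landed).
[folklore] Elementary algebra of cubics; intermediate value theorem.
-/

-- `Summit.ValiantsHypothesis.ValiantsHypothesis.…` repeats a component by the D-0017 layout
-- (single-conjunct summit), which the `dupNamespace` linter flags; the name is mandated.
set_option linter.dupNamespace false

namespace Summit.ValiantsHypothesis.ValiantsHypothesis.Theorems.LacunarySymmetroidMatrixDescartes.Census.EqualDiagonal

open Matrix Finset
open scoped BigOperators

/-! ## 11. A real cubic has a real root; the discriminant at a root; the dichotomy of a really-nondegenerate annihilator pencil -/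

/-- A real cubic with positive leading coefficient has a real root (intermediate value theorem on `[−M, M]`,
`M = 1 + (|a₂|+|a₁|+|a₀|)/a₃`). [folklore] -/
theorem exists_root_cubic_of_pos (a₀ a₁ a₂ a₃ : ℝ) (ha : 0 < a₃) :
    ∃ x : ℝ, a₃ * x ^ 3 + a₂ * x ^ 2 + a₁ * x + a₀ = 0 := by
  set A := |a₂| + |a₁| + |a₀| with hA
  have hA0 : 0 ≤ A := by positivity
  set M := 1 + A / a₃ with hM
  have hM1 : 1 ≤ M := by rw [hM]; have := div_nonneg hA0 ha.le; linarith
  have hM0 : 0 ≤ M := by linarith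
  have hMA : A < a₃ * M := by rw [hM, mul_add, mul_one, mul_div_cancel₀ _ ha.ne']; linarith
  set f : ℝ → ℝ := fun x => a₃ * x ^ 3 + a₂ * x ^ 2 + a₁ * x + a₀ with hf
  have hcont : Continuous f := by rw [hf]; fun_prop
  have h2 := neg_abs_le a₂; have h2' := le_abs_self a₂
  have h1 := neg_abs_le a₁; have h1' := le_abs_self a₁
  have h0 := neg_abs_le a₀; have h0' := le_abs_self a₀
  have hMM : M ≤ M ^ 2 := by nlinarith
  have hM2 : 1 ≤ M ^ 2 := by nlinarith
  have hpos : 0 < f M := by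
    have : M ^ 2 * (a₃ * M - A) ≤ f M := by
      simp only [hf]
      nlinarith [mul_nonneg (abs_nonneg a₂) (sq_nonneg M), mul_nonneg (abs_nonneg a₁) hM0, abs_nonneg a₀,
        mul_le_mul_of_nonneg_left hMM (abs_nonneg a₁), mul_le_mul_of_nonneg_left hM2 (abs_nonneg a₀)]
    have : 0 < M ^ 2 * (a₃ * M - A) := mul_pos (by positivity) (by linarith)
    linarith
  have hneg : f (-M) < 0 := by
    have : f (-M) ≤ -(M ^ 2 * (a₃ * M - A)) := by
      simp only [hf]
      nlinarith [mul_nonneg (abs_nonneg a₂) (sq_nonneg M), mul_nonneg (abs_nonneg a₁) hM0, abs_nonneg a₀,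
        mul_le_mul_of_nonneg_left hMM (abs_nonneg a₁), mul_le_mul_of_nonneg_left hM2 (abs_nonneg a₀)]
    have : 0 < M ^ 2 * (a₃ * M - A) := mul_pos (by positivity) (by linarith)
    linarith
  have hivt := intermediate_value_Icc (show -M ≤ M by linarith) hcont.continuousOn
  obtain ⟨x, -, hx⟩ := hivt ⟨hneg.le, hpos.le⟩
  exact ⟨x, hx⟩

/-- A real cubic (`a₃ ≠ 0`) has a real root. [folklore] -/
theorem exists_root_cubic (a₀ a₁ a₂ a₃ : ℝ) (ha : a₃ ≠ 0) :
    ∃ x : ℝ, a₃ * x ^ 3 + a₂ * x ^ 2 + a₁ * x + a₀ = 0 := by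
  rcases lt_or_gt_of_ne ha with h | h
  · obtain ⟨x, hx⟩ := exists_root_cubic_of_pos (-a₀) (-a₁) (-a₂) (-a₃) (by linarith)
    exact ⟨x, by linarith⟩
  · exact exists_root_cubic_of_pos a₀ a₁ a₂ a₃ h

/-- **The discriminant at a root**: if `p(μ) = 0` for the cubic `p = a₃x³ + a₂x² + a₁x + a₀`, then with `p(μ + y) = a₃y³ + b₂y² + b₁y`
(`b₂ = 3a₃μ + a₂`, `b₁ = 3a₃μ² + 2a₂μ + a₁ = p′(μ)`) one has `Disc(p) = b₁²·(b₂² − 4a₃b₁)`: the discriminant is the square of the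
derivative at the root times the discriminant of the residual quadratic. [folklore] -/
theorem cubic_discr_at_root (a₀ a₁ a₂ a₃ μ : ℝ) (hp : a₃ * μ ^ 3 + a₂ * μ ^ 2 + a₁ * μ + a₀ = 0) :
    a₂ ^ 2 * a₁ ^ 2 - 4 * a₃ * a₁ ^ 3 - 4 * a₂ ^ 3 * a₀ - 27 * a₃ ^ 2 * a₀ ^ 2 + 18 * a₃ * a₂ * a₁ * a₀
      = (3 * a₃ * μ ^ 2 + 2 * a₂ * μ + a₁) ^ 2 * ((3 * a₃ * μ + a₂) ^ 2 - 4 * a₃ * (3 * a₃ * μ ^ 2 + 2 * a₂ * μ + a₁)) := by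
  have hc : a₀ = -(a₁ * μ + a₂ * μ ^ 2 + a₃ * μ ^ 3) := by linarith
  subst hc
  ring

/-- The annihilator cubic, expanded: `det (B₂ − xB₁) = det B₂ − x·tr(adj B₂·B₁) + x²·tr(adj B₁·B₂) − x³·det B₁`. [folklore] -/
theorem det_sub_smul_expand (B₁ B₂ : Matrix (Fin 3) (Fin 3) ℝ) (x : ℝ) :
    (B₂ - x • B₁).det = B₂.det - x * (B₂.adjugate * B₁).trace + x ^ 2 * (B₁.adjugate * B₂).trace - x ^ 3 * B₁.det := by
  rw [show B₂ - x • B₁ = B₂ + (-x) • B₁ by rw [neg_smul, sub_eq_add_neg], det_add_smul_fin_three]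
  ring

/-- **DICHOTOMY OF A REALLY NON-DEGENERATE ANNIHILATOR PENCIL.**  Let `B₁, B₂` be real `3 × 3` matrices with `det B₁ ≠ 0` and suppose the
cubic `p(x) = det (B₂ − xB₁)` has NON-ZERO DISCRIMINANT (in the coefficients `a₃ = −det B₁`, `a₂ = tr(adj B₁·B₂)`, `a₁ = −tr(adj B₂·B₁)`,
`a₀ = det B₂`).  Then EITHER `p` has three distinct real roots (the really-split sector of `exists_congr_signedEqualDiag`) OR `p` has a unique
real root, which is simple (the R2 sector of `exists_congr_hollowCorner_of_uniqueRoot`). [folklore] -/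
theorem annihilator_dichotomy (B₁ B₂ : Matrix (Fin 3) (Fin 3) ℝ) (hdet : B₁.det ≠ 0)
    (hdisc : (B₁.adjugate * B₂).trace ^ 2 * (-(B₂.adjugate * B₁).trace) ^ 2
        - 4 * (-B₁.det) * (-(B₂.adjugate * B₁).trace) ^ 3 - 4 * (B₁.adjugate * B₂).trace ^ 3 * B₂.det
        - 27 * (-B₁.det) ^ 2 * B₂.det ^ 2
        + 18 * (-B₁.det) * (B₁.adjugate * B₂).trace * (-(B₂.adjugate * B₁).trace) * B₂.det ≠ 0) :
    (∃ μ : Fin 3 → ℝ, Function.Injective μ ∧ ∀ i, (B₂ - μ i • B₁).det = 0) ∨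
    (∃ μ : ℝ, (B₂ - μ • B₁).det = 0 ∧ (∀ x : ℝ, (B₂ - x • B₁).det = 0 → x = μ) ∧
      ((B₂ - μ • B₁).adjugate * B₁).trace ≠ 0) := by
  set a₃ := -B₁.det with ha₃
  set a₂ := (B₁.adjugate * B₂).trace with ha₂
  set a₁ := -(B₂.adjugate * B₁).trace with ha₁
  set a₀ := B₂.det with ha₀
  have hp : ∀ x, (B₂ - x • B₁).det = a₃ * x ^ 3 + a₂ * x ^ 2 + a₁ * x + a₀ := fun x => by
    rw [det_sub_smul_expand, ha₃, ha₂, ha₁, ha₀]; ring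
  obtain ⟨μ, hμ⟩ := exists_root_cubic a₀ a₁ a₂ a₃ (by rw [ha₃]; exact neg_ne_zero.mpr hdet)
  have hroot : (B₂ - μ • B₁).det = 0 := by rw [hp]; exact hμ
  -- the residual quadratic at `μ`
  set b₂ := 3 * a₃ * μ + a₂ with hb₂
  set b₁ := 3 * a₃ * μ ^ 2 + 2 * a₂ * μ + a₁ with hb₁
  have hshift : ∀ y, (B₂ - (μ + y) • B₁).det = y * (a₃ * y ^ 2 + b₂ * y + b₁) := by
    intro y; rw [hp]
    have : a₀ = -(a₃ * μ ^ 3 + a₂ * μ ^ 2 + a₁ * μ) := by linarith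
    rw [this, hb₂, hb₁]; ring
  have hD := cubic_discr_at_root a₀ a₁ a₂ a₃ μ hμ
  rw [hD] at hdisc
  have hb₁ne : b₁ ≠ 0 := by
    intro h0; apply hdisc; rw [← hb₁, h0]; ring
  have hΔne : b₂ ^ 2 - 4 * a₃ * b₁ ≠ 0 := by
    intro h0; apply hdisc; rw [← hb₁, ← hb₂, h0]; ring
  -- simplicity: the linear coefficient of `p(μ + y)` is `b₁ = −tr(adj(B₂ − μB₁)·B₁)`
  have hK : ∀ y, (B₂ - (μ + y) • B₁).det
      = -y * ((B₂ - μ • B₁).adjugate * B₁).trace + y ^ 2 * (B₁.adjugate * (B₂ - μ • B₁)).trace + -(y ^ 3) * B₁.det := by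
    intro y
    rw [show B₂ - (μ + y) • B₁ = (B₂ - μ • B₁) + (-y) • B₁ by rw [add_smul, neg_smul]; abel, det_add_smul_fin_three, hroot]
    ring
  have hcoef := cubic_coeff_unique b₁ b₂ a₃ (-((B₂ - μ • B₁).adjugate * B₁).trace) ((B₁.adjugate * (B₂ - μ • B₁)).trace)
    (-B₁.det) (fun y => by have h1 := hshift y; have h2 := hK y; rw [h1] at h2; linear_combination h2)
  have ht₁ : ((B₂ - μ • B₁).adjugate * B₁).trace ≠ 0 := by
    intro h0; apply hb₁ne; rw [hcoef.1, h0, neg_zero]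
  have ha₃ne : a₃ ≠ 0 := by rw [ha₃]; exact neg_ne_zero.mpr hdet
  rcases lt_or_gt_of_ne hΔne with hΔ | hΔ
  · -- `Δ < 0`: no other real root
    right
    refine ⟨μ, hroot, fun x hx => ?_, ht₁⟩
    have h1 := hshift (x - μ)
    rw [add_sub_cancel, hx] at h1
    rcases mul_eq_zero.mp h1.symm with h2 | h2
    · linarith
    · exfalso
      have hne : a₃ * ((x - μ) * (x - μ)) + b₂ * (x - μ) + b₁ ≠ 0 :=
        quadratic_ne_zero_of_discrim_ne_sq
          (fun s (hs : discrim a₃ b₂ b₁ = s ^ 2) => by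
            have : (0 : ℝ) ≤ s ^ 2 := sq_nonneg s
            rw [discrim] at hs; linarith) (x - μ)
      exact hne (by linear_combination h2)
  · -- `Δ > 0`: two further real roots, distinct from each other and from `μ`
    left
    set s := Real.sqrt (b₂ ^ 2 - 4 * a₃ * b₁) with hs
    have hss : s * s = b₂ ^ 2 - 4 * a₃ * b₁ := Real.mul_self_sqrt hΔ.le
    have hspos : 0 < s := Real.sqrt_pos.mpr hΔ
    have hdq : discrim a₃ b₂ b₁ = s * s := by rw [discrim, hss, sq]
    set y₁ := (-b₂ + s) / (2 * a₃) with hy₁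
    set y₂ := (-b₂ - s) / (2 * a₃) with hy₂
    have hq₁ : a₃ * (y₁ * y₁) + b₂ * y₁ + b₁ = 0 := (quadratic_eq_zero_iff ha₃ne hdq y₁).mpr (Or.inl rfl)
    have hq₂ : a₃ * (y₂ * y₂) + b₂ * y₂ + b₁ = 0 := (quadratic_eq_zero_iff ha₃ne hdq y₂).mpr (Or.inr rfl)
    have hy₁0 : y₁ ≠ 0 := by intro h0; rw [h0] at hq₁; apply hb₁ne; linarith
    have hy₂0 : y₂ ≠ 0 := by intro h0; rw [h0] at hq₂; apply hb₁ne; linarith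
    have hy12 : y₁ ≠ y₂ := by
      intro h; rw [hy₁, hy₂, div_eq_div_iff (mul_ne_zero two_ne_zero ha₃ne) (mul_ne_zero two_ne_zero ha₃ne)] at h
      have : s * (2 * a₃) = 0 := by linarith
      rcases mul_eq_zero.mp this with h' | h'
      · exact hspos.ne' h'
      · exact (mul_ne_zero two_ne_zero ha₃ne) h'
    refine ⟨![μ, μ + y₁, μ + y₂], ?_, ?_⟩
    · intro i j hij
      fin_cases i <;> fin_cases j <;> simp at hij ⊢ <;> first | exact absurd hij hy₁0 | exact absurd hij.symm hy₁0 | exact absurd hij hy₂0 | exact absurd hij.symm hy₂0 | exact absurd hij hy12 | exact absurd hij.symm hy12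
    · intro i
      fin_cases i
      · simpa using hroot
      · show (B₂ - (μ + y₁) • B₁).det = 0
        rw [hshift]; rw [show a₃ * y₁ ^ 2 + b₂ * y₁ + b₁ = a₃ * (y₁ * y₁) + b₂ * y₁ + b₁ by ring, hq₁, mul_zero]
      · show (B₂ - (μ + y₂) • B₁).det = 0
        rw [hshift]; rw [show a₃ * y₂ ^ 2 + b₂ * y₂ + b₁ = a₃ * (y₂ * y₂) + b₂ * y₂ + b₁ by ring, hq₂, mul_zero]

/-! ## 12. The combined chart reduction off the discriminant -/

/-- **THE DOOR-A ROW OFF THE DISCRIMINANT REDUCES TO THE TWO SIXTEEN-PARAMETER CHART FAMILIES.**  Suppose that on the exponent vector `d`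
every SIGNED-EQUAL-DIAGONAL pencil `∑ X^{d_l}[[ε₀δ_l,α_l,β_l],[α_l,ε₁δ_l,γ_l],[β_l,γ_l,ε₂δ_l]]` (`εᵢ = ±1`) and every HOLLOW-CORNER pencil
`∑ X^{d_l}[[ε₁u_l+ε₂w_l,α_l,β_l],[α_l,u_l,0],[β_l,0,w_l]]` (`εᵢ ∈ {1,0,−1}`) has at most `N` distinct positive det-roots.  Then every real
symmetric `(3,4)` pencil on `d` whose letters are annihilated by symmetric `B₁, B₂` with `det B₁ ≠ 0` and NON-ZERO DISCRIMINANT of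
`x ↦ det(B₂ − xB₁)` has at most `N` distinct positive det-roots. [folklore] -/
theorem card_posRoots_le_of_chartRows (d : Fin 4 → ℕ) {N : ℕ}
    (hED : ∀ (ε : Fin 3 → ℝ) (δ α β γ : Fin 4 → ℝ), (∀ i, ε i = 1 ∨ ε i = -1) →
      ((Matrix.det (∑ l, ((Polynomial.X : Polynomial ℝ) ^ d l) •
          (!![ε 0 * δ l, α l, β l; α l, ε 1 * δ l, γ l; β l, γ l, ε 2 * δ l] : Matrix (Fin 3) (Fin 3) ℝ).map Polynomial.C)).roots.toFinset.filter
            (fun t => 0 < t)).card ≤ N)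
    (hHC : ∀ (ε₁ ε₂ : ℝ) (u w α β : Fin 4 → ℝ), (ε₁ = 1 ∨ ε₁ = 0 ∨ ε₁ = -1) → (ε₂ = 1 ∨ ε₂ = 0 ∨ ε₂ = -1) →
      ((Matrix.det (∑ l, ((Polynomial.X : Polynomial ℝ) ^ d l) •
          (!![ε₁ * u l + ε₂ * w l, α l, β l; α l, u l, 0; β l, 0, w l] : Matrix (Fin 3) (Fin 3) ℝ).map Polynomial.C)).roots.toFinset.filter
            (fun t => 0 < t)).card ≤ N)
    (S : Fin 4 → Matrix (Fin 3) (Fin 3) ℝ) (hS : ∀ l, (S l).IsSymm)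
    (B₁ B₂ : Matrix (Fin 3) (Fin 3) ℝ) (hB₁ : B₁.IsSymm) (hB₂ : B₂.IsSymm) (hdet : B₁.det ≠ 0)
    (hann₁ : ∀ l, (B₁ * S l).trace = 0) (hann₂ : ∀ l, (B₂ * S l).trace = 0)
    (hdisc : (B₁.adjugate * B₂).trace ^ 2 * (-(B₂.adjugate * B₁).trace) ^ 2
        - 4 * (-B₁.det) * (-(B₂.adjugate * B₁).trace) ^ 3 - 4 * (B₁.adjugate * B₂).trace ^ 3 * B₂.det
        - 27 * (-B₁.det) ^ 2 * B₂.det ^ 2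
        + 18 * (-B₁.det) * (B₁.adjugate * B₂).trace * (-(B₂.adjugate * B₁).trace) * B₂.det ≠ 0) :
    ((Matrix.det (∑ l, ((Polynomial.X : Polynomial ℝ) ^ d l) • (S l).map Polynomial.C)).roots.toFinset.filter
        (fun t => 0 < t)).card ≤ N := by
  rcases annihilator_dichotomy B₁ B₂ hdet hdisc with ⟨μ, hμ, hroots⟩ | ⟨μ, hroot, huniq, hsimple⟩
  · exact card_posRoots_le_of_signedEqualDiag_rows d hED S hS B₁ B₂ hB₁ hB₂ hdet hann₁ hann₂ μ hμ hroots
  · exact card_posRoots_le_of_hollowCorner_rows_uniqueRoot d hHC S hS B₁ B₂ hB₁ hB₂ hdet hann₁ hann₂ μ hroot huniq hsimple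

end Summit.ValiantsHypothesis.ValiantsHypothesis.Theorems.LacunarySymmetroidMatrixDescartes.Census.EqualDiagonal
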